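import Summits.ValiantsHypothesis.ValiantsHypothesis.Theorems.BarrierLeverAnchoredDoorHitsLowerPairsGapOne

/-!
# Support item `AnchoredDoorHitsLowerPairs` (stmt-ValiantsHypothesis-22510), line `anchored-peeling`:
# THE GAP-ONE STEP in induction form (hypotheses = symbolic minors of ENUMERATIONS of the deletion and link pairs)

Helper file (`--supports stmt-ValiantsHypothesis-22510`; cell valiant-natproofs, rung V4, 𝒟-side door (c); registered line
`Cruxes/AnchoredDoorHitsLowerPairs/Lines/anchored_peeling.lean` v13; prover seat val-np-p1 gen 19). Definition-free. Closes NO item.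

`symbolicDet_ne_zero_of_gapOne` (file `…GapOne`) is stated with reindexing equivalences and block minors. This file restates it in the shape the
skeleton's strong induction consumes (pattern of `Stmt.stub_starStep`, `det_deletionBlock_ne_zero`): for a vertex `a` of the row complex and a vertex `c` of
the column complex with `#{i : a ∉ u i} = #{j : c ∉ w j} + 1` (equivalently `ℓ_c = ℓ_a + 1`), a deletion row `u i₀ ∌ a` and a column `w j₀ ∋ c` to drop, IF
every injective enumeration of the pair `({S ∈ R : a ∉ S, S ≠ u i₀}, {T ∈ C : c ∉ T})` and of the pair `({S ∖ a : S ∋ a}, {T ∖ c : T ∋ c, T ≠ w j₀})` has a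
nonzero symbolic minor, then so has `(u, w)`. With `u i₀` maximal in `del_a R` and `w j₀` maximal in `lk_c C`-plus-`c` both smaller pairs are LOWER, so the
skeleton's induction hypothesis discharges them: the gap-one step joins the star step (gap 0) as an unconditional structural move.

* `symbolicDet_ne_zero_of_gapOne'` — the induction form.

WHAT THIS IS NOT: not the registered stub `Stmt.stub_uqFaceStep` (face targets, larger gaps); nothing on crux stmt-ValiantsHypothesis-14610 or on `VP` versus `VNP`.
-/

set_option linter.dupNamespace false

open Matrix

namespace Summit.ValiantsHypothesis.ValiantsHypothesis.Theorems.BarrierLever.AnchoredPeeling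

open Finset MvPolynomial
open Summit.ValiantsHypothesis.ValiantsHypothesis.Theorems.BarrierLever.BrickCalculus (pexpo pexpo_def pexpo_le_iff pexpo_sub)

noncomputable section

variable {s h r : ℕ} {u w : Fin r → Finset (Fin h)} {a c : Fin h}

/-- **THE GAP-ONE STEP, induction form.** -/
theorem symbolicDet_ne_zero_of_gapOne' (hs : 1 ≤ s) (hu : Function.Injective u) (hw : Function.Injective w)
    (hw0 : ∃ j, w j = ∅)
    (hgap : Fintype.card {i : Fin r // ¬ (a ∈ u i)} = Fintype.card {j : Fin r // c ∉ w j} + 1)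
    (i₀ : Fin r) (hi₀ : a ∉ u i₀)
    (H1 : ∀ (r₁ : ℕ) (u₁ w₁ : Fin r₁ → Finset (Fin h)), Function.Injective u₁ → Function.Injective w₁ →
      Set.range u₁ = {S | S ∈ Set.range u ∧ a ∉ S ∧ S ≠ u i₀} → Set.range w₁ = {T | T ∈ Set.range w ∧ c ∉ T} →
      symbolicDet s h r₁ u₁ w₁ ≠ 0)
    (j₀ : Fin r) (hj₀ : c ∈ w j₀)
    (H2 : ∀ (r₂ : ℕ) (u₂ w₂ : Fin r₂ → Finset (Fin h)), Function.Injective u₂ → Function.Injective w₂ →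
      Set.range u₂ = {S | a ∉ S ∧ insert a S ∈ Set.range u} → Set.range w₂ = {T | c ∉ T ∧ insert c T ∈ Set.range w ∧ insert c T ≠ w j₀} →
      symbolicDet s h r₂ u₂ w₂ ≠ 0) :
    symbolicDet s h r u w ≠ 0 := by
  classical
  -- the four reindexings
  set n := Fintype.card {j : Fin r // c ∉ w j} with hn
  set n' := Fintype.card {i : Fin r // a ∈ u i} with hn'
  have hcardC : Fintype.card {j : Fin r // ¬ (c ∉ w j)} = n' + 1 := by
    have h1 := Fintype.card_subtype_compl (fun i : Fin r => a ∈ u i)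
    have h2 := Fintype.card_subtype_compl (fun j : Fin r => c ∉ w j)
    have h3 : Fintype.card {j : Fin r // c ∉ w j} ≤ Fintype.card (Fin r) := Fintype.card_subtype_le _
    have h4 : Fintype.card {i : Fin r // a ∈ u i} ≤ Fintype.card (Fin r) := Fintype.card_subtype_le _
    omega
  let eA : {i : Fin r // ¬ (a ∈ u i)} ≃ Fin (n + 1) := Fintype.equivFinOfCardEq hgap
  let eQ : {j : Fin r // c ∉ w j} ≃ Fin n := Fintype.equivFinOfCardEq rfl
  let eP : {i : Fin r // a ∈ u i} ≃ Fin n' := Fintype.equivFinOfCardEq rfl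
  let eC : {j : Fin r // ¬ (c ∉ w j)} ≃ Fin (n' + 1) := Fintype.equivFinOfCardEq hcardC
  let x₀ : Fin (n + 1) := eA ⟨i₀, hi₀⟩
  let y₀ : Fin (n' + 1) := eC ⟨j₀, not_not.mpr hj₀⟩
  refine symbolicDet_ne_zero_of_gapOne hs hu hw hw0 eA eQ eP eC x₀ ?_ y₀ ?_
  · -- (H1): the tall block minus row x₀ is the symbolic minor of an enumeration of the reduced deletion pair
    let u₁ : Fin n → Finset (Fin h) := fun k => u (eA.symm (x₀.succAbove k)).1
    let w₁ : Fin n → Finset (Fin h) := fun l => w (eQ.symm l).1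
    have hmat : (tallBlock (peelMatrix s h r u w a c) (fun i => a ∈ u i) (fun j => c ∉ w j) eA eQ).submatrix x₀.succAbove id =
        Matrix.of fun k l => coeff (pexpo (u₁ k) (w₁ l)) (symbolicWitness s h) := by
      refine Matrix.ext (fun k l => ?_)
      show peelMatrix s h r u w a c (eA.symm (x₀.succAbove k)).1 (eQ.symm l).1 = _
      rw [Matrix.of_apply]
      exact peelMatrix_del u w a c (eA.symm (x₀.succAbove k)).2 _
    rw [hmat]
    refine H1 n u₁ w₁ ?_ ?_ ?_ ?_
    · intro k k' hkk
      have := hu hkk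
      exact Fin.succAbove_right_injective (eA.symm.injective (Subtype.val_injective this))
    · intro l l' hll
      exact eQ.symm.injective (Subtype.val_injective (hw hll))
    · ext S
      constructor
      · rintro ⟨k, rfl⟩
        refine ⟨⟨_, rfl⟩, (eA.symm (x₀.succAbove k)).2, fun hS => ?_⟩
        have hidx : (eA.symm (x₀.succAbove k)).1 = i₀ := hu hS
        have : x₀.succAbove k = x₀ := by
          have h' : eA.symm (x₀.succAbove k) = ⟨i₀, hi₀⟩ := Subtype.ext hidx
          rw [← eA.apply_symm_apply (x₀.succAbove k), h']
        exact Fin.succAbove_ne x₀ k this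
      · rintro ⟨⟨i, rfl⟩, hai, hne⟩
        have hne' : eA ⟨i, hai⟩ ≠ x₀ := fun h' => hne (by
          have := congrArg (fun z => (eA.symm z).1) h'
          simp only [Equiv.symm_apply_apply, x₀] at this
          rw [this])
        obtain ⟨k, hk⟩ := Fin.exists_succAbove_eq hne'
        exact ⟨k, by show u (eA.symm (x₀.succAbove k)).1 = u i; rw [hk, Equiv.symm_apply_apply]⟩
    · ext T
      constructor
      · rintro ⟨l, rfl⟩
        exact ⟨⟨_, rfl⟩, (eQ.symm l).2⟩
      · rintro ⟨⟨j, rfl⟩, hcj⟩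
        exact ⟨eQ ⟨j, hcj⟩, by show w (eQ.symm (eQ ⟨j, hcj⟩)).1 = w j; rw [Equiv.symm_apply_apply]⟩
  · -- (H2): the wide block minus column y₀ is the symbolic minor of an enumeration of the reduced link pair
    let u₂ : Fin n' → Finset (Fin h) := fun k => (u (eP.symm k).1).erase a
    let w₂ : Fin n' → Finset (Fin h) := fun l => (w (eC.symm (y₀.succAbove l)).1).erase c
    have hcw : ∀ z : {j : Fin r // ¬ (c ∉ w j)}, c ∈ w z.1 := fun z => not_not.mp z.2
    have hmat : (wideBlock (peelMatrix s h r u w a c) (fun i => a ∈ u i) (fun j => c ∉ w j) eP eC).submatrix id y₀.succAbove =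
        Matrix.of fun k l => coeff (pexpo (u₂ k) (w₂ l)) (symbolicWitness s h) := by
      refine Matrix.ext (fun k l => ?_)
      show peelMatrix s h r u w a c (eP.symm k).1 (eC.symm (y₀.succAbove l)).1 = _
      rw [Matrix.of_apply]
      exact peelMatrix_link_of_mem u w a c (eP.symm k).2 (hcw _)
    rw [hmat]
    have herase_u : ∀ z z' : {i : Fin r // a ∈ u i}, (u z.1).erase a = (u z'.1).erase a → z = z' := by
      intro z z' hzz
      apply Subtype.ext; apply hu
      rw [← Finset.insert_erase z.2, ← Finset.insert_erase z'.2, hzz]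
    have herase_w : ∀ z z' : {j : Fin r // ¬ (c ∉ w j)}, (w z.1).erase c = (w z'.1).erase c → z = z' := by
      intro z z' hzz
      apply Subtype.ext; apply hw
      rw [← Finset.insert_erase (hcw z), ← Finset.insert_erase (hcw z'), hzz]
    refine H2 n' u₂ w₂ ?_ ?_ ?_ ?_
    · intro k k' hkk
      exact eP.symm.injective (herase_u _ _ hkk)
    · intro l l' hll
      exact Fin.succAbove_right_injective (eC.symm.injective (herase_w _ _ hll))
    · ext S
      constructor
      · rintro ⟨k, rfl⟩
        refine ⟨Finset.notMem_erase a _, ⟨(eP.symm k).1, ?_⟩⟩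
        show u (eP.symm k).1 = insert a ((u (eP.symm k).1).erase a)
        rw [Finset.insert_erase (eP.symm k).2]
      · rintro ⟨haS, ⟨i, hi⟩⟩
        have hai : a ∈ u i := by rw [hi]; exact Finset.mem_insert_self a S
        refine ⟨eP ⟨i, hai⟩, ?_⟩
        show (u (eP.symm (eP ⟨i, hai⟩)).1).erase a = S
        rw [Equiv.symm_apply_apply, hi, Finset.erase_insert haS]
    · ext T
      constructor
      · rintro ⟨l, rfl⟩
        refine ⟨Finset.notMem_erase c _, ⟨(eC.symm (y₀.succAbove l)).1, ?_⟩, fun hT => ?_⟩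
        · show w (eC.symm (y₀.succAbove l)).1 = insert c ((w (eC.symm (y₀.succAbove l)).1).erase c)
          rw [Finset.insert_erase (hcw _)]
        · rw [Finset.insert_erase (hcw _)] at hT
          have hidx : (eC.symm (y₀.succAbove l)).1 = j₀ := hw hT
          have : y₀.succAbove l = y₀ := by
            have h' : eC.symm (y₀.succAbove l) = ⟨j₀, not_not.mpr hj₀⟩ := Subtype.ext hidx
            rw [← eC.apply_symm_apply (y₀.succAbove l), h']
          exact Fin.succAbove_ne y₀ l this
      · rintro ⟨hcT, ⟨j, hj⟩, hne⟩
        have hcj : c ∈ w j := by rw [hj]; exact Finset.mem_insert_self c T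
        have hne' : eC ⟨j, not_not.mpr hcj⟩ ≠ y₀ := fun h' => hne (by
          have := congrArg (fun z => (eC.symm z).1) h'
          simp only [Equiv.symm_apply_apply, y₀] at this
          rw [← hj, this])
        obtain ⟨l, hl⟩ := Fin.exists_succAbove_eq hne'
        refine ⟨l, ?_⟩
        show (w (eC.symm (y₀.succAbove l)).1).erase c = T
        rw [hl, Equiv.symm_apply_apply, hj, Finset.erase_insert hcT]

end

end Summit.ValiantsHypothesis.ValiantsHypothesis.Theorems.BarrierLever.AnchoredPeeling
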